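import Summits.BirchSwinnertonDyer.BirchSwinnertonDyer.Theorems.KatoDescentTamePotSupersingularCartanMuRoadDoorsTprimeFive
import Summits.BirchSwinnertonDyer.BirchSwinnertonDyer.Theorems.KatoDescentTamePotSupersingularCartanMuRoadFukudaDoorsTprime
import Literature.NumberTheory.EllipticCurves.FineSelmerMuRoadSplitCartanFiveAbelian
import Literature.NumberTheory.IwasawaTheory.Fukuda1994Thm1RankProofs
import Literature.NumberTheory.IwasawaTheory.ClassicalMuInvariantOnePrimeProofs
import Summits.BirchSwinnertonDyer.BirchSwinnertonDyer.Theorems.KatoDescentTamePotSupersingularCartanMuRoadSplitFiveIndexTwoAbelDoors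
import HarnessLib

/-!
# KT `p = 5` SPLIT-Cartan μ-road WITHOUT Ferrero–Washington: the (A) / U₀ doors from the six leaves `ℚ(P₁)`, `ℚ(W[5])^⟨σ̄_u²σ̄_v⟩`, `ℚ(C)`,
# `K′`, `ℚ(ζ₅)`, `Q₂` — μ-form and CLASS-DATA form (five Iwasawa-1956 certificates + ONE Fukuda rank equality)
# (cell `bsd-potss`, seat `bsd-potss-k8t-c4` g24; route-free; `--supports stmt-BirchSwinnertonDyer-19982 --as helper`; closes nothing)

HONEST FRAMING. Route-free THEOREMS ONLY (no definition, no named fact, no `sorry`). conjA-anchor g11's road R5 / k8t-c4 g17's door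
`CartanMuRoadDoorsTprimeFive.missingUpperBoundAt_five_tame_of_splitCartanBasis_of_mu` display `hCS` (Coates–Sujatha Thm. 3.4 — a tree theorem since g22)
and `hFW` (Ferrero–Washington). By the character count of `Literature/…/ClassicalMuVanishesSplitCartanFiveDescentAbelian` (g24) Ferrero–Washington
entered only through three ABELIAN subfields of `L = ℚ(W[5])` (image `C_s⁺(5)`, `#G = 32`): the cyclic quartic `K′ = L^⟨σ̄_uσ̄_v⁻¹, σ̄_w⟩ ⊇ ℚ(√5)`,
`Z = L^⟨σ̄_uσ̄_v⁻¹, σ̄_u²σ̄_w⟩ = L^{ker det} = ℚ(ζ₅)` and the quadratic `Q₂ = L^⟨σ̄_uσ̄_v⁻¹, σ̄_wσ̄_u⟩ = ℚ(√(5d₁))` (`d₁ = disc L^{C_s(5)}`); the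
leaf `ℚ(xP₁) ⊆ ℚ(P₁)` is redundant. THIS FILE: §1 (A) at `(W,5)` and U₀ from the basis data + SIX μ-hypotheses (NO named fact for (A);
`hKatoA hGZK hmod` for U₀); §2 the same from CLASS DATA — for each of the five leaves `ℚ(P₁)`, `L^⟨σ̄_u²σ̄_v⟩`, `ℚ(C)`, `K′`, `Z`: «`5 ∤ h` and one
prime above `5`» (Iwasawa 1956, PROVED: `iwasawa1956_…_holds`), and for `Q₂`: ONE rank equality `rank₅ Cl((Q₂)_{m+1}) = rank₅ Cl((Q₂)_m)` on its
cyclotomic `ℤ_5`-tower (Fukuda 1994 Thm. 1 (2), PROVED: `fukuda1994_thm1_classGroupPRank_const_of_succ_eq_holds`; total ramification from layer 0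
is KERNEL for subfields of `ℚ(W[5])` with `5 ∤ #Gal`: `totallyRamifiedFrom_zero_intermediateField_divisionField`). On the census rows 283200dw1,
283200gf1 (the `p = 5` Conj-A residue row of 19916), 434400l1: `K′ = ℚ(ζ₂₀)⁺` (`x⁴−5x²+5`, h = 1), `Z = ℚ(ζ₅)` (h = 1), `Q₂ = ℚ(i)` — where `5`
SPLITS, so Iwasawa 1956 is void and `λ₅(ℚ(i)) ≥ 1` (Gold): the rank datum at layers `(1,2)` is the certificate (kit, GRH-marked in the records).
Nothing is asserted about any curve; (A), Conjecture A and BSD are proved for no curve here.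
[cite: Kato2004Asterisque, Thm. 14.5 (3) (p. 236), Thm. 12.5 (3) (p. 222)] [cite: CoatesSujatha2005, Thm. 3.4 (§3)] [cite: Fukuda1994, Thm. 1, p. 264]
[cite: Greenberg2001IwasawaPastPresent, Prop. (2.1) (p. 339)] [cite: Serre1972, §2.2] [cite: Washington1997, §7.5, §13.1] [cite: Lemmermeyer1994, §1]
-/

set_option linter.dupNamespace false
set_option autoImplicit false

noncomputable section

open scoped Classical NumberField Matrix
open Field IntermediateField WeierstrassCurve Literature.NumberTheory.EllipticCurves
  Literature.NumberTheory.EllipticCurves.Rank1Residual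
  Literature.NumberTheory.EllipticCurves.Rank1Residual.Typed
  Literature.NumberTheory.GaloisRepresentations Literature.NumberTheory.SerreUniformity
  Literature.NumberTheory.IwasawaTheory
  Summit.BirchSwinnertonDyer.Rank1Residual Summit.BirchSwinnertonDyer.Rank1Residual.Additive

namespace Summit.BirchSwinnertonDyer.BirchSwinnertonDyer.Theorems.CartanMuRoadSplitFiveAbelDoors

/-! ### §0 Leaf tools: Iwasawa 1956 and Fukuda (2) on subfields of `ℚ(W[5])` -/

section Leaves

variable (W : WeierstrassCurve ℚ) [W.IsElliptic]

/-- **Fukuda (2) leaf on a subfield `K ⊆ ℚ(W[5])`** (`W[5]` irreducible, split-Cartan-normaliser image, so `5 ∤ #Gal(ℚ(W[5])/ℚ)` and every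
cyclotomic `ℤ_5`-tower of `K` is totally ramified at `5` from layer `0` — KERNEL): ONE rank equality `rank₅ Cl(K_{m+1}) = rank₅ Cl(K_m)` gives
`μ = 0` for every cyclotomic `ℤ_5`-extension of `K` (PROVED: `fukuda1994_thm1_classGroupPRank_const_of_succ_eq_holds`). [cite: Fukuda1994, Thm. 1 (2), p. 264]
[cite: Serre1972, §2.2, §2.4 Prop. 15] [cite: Washington1997, §13.1, Prop. 13.2] -/
theorem leafMu_of_rankSuccEqAt [Fact (Nat.Prime 5)] (hirr : W.HasIrreducibleModPGaloisRep 5)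
    (himg : HasSplitCartanNormalizerModPImage W 5)
    (K : IntermediateField ℚ ↥(W.divisionField 5)) (m : ℕ)
    (hrk : haveI : NumberField ↥(W.divisionField 5) := NumberField.mk
      ∀ κE : ZpExtension ↥K 5, κE.IsCyclotomic → classGroupPRank κE (m + 1) = classGroupPRank κE m) :
    haveI : NumberField ↥(W.divisionField 5) := NumberField.mk
    ∀ κE : ZpExtension ↥K 5, κE.IsCyclotomic → ClassicalMuVanishes κE := by
  haveI : NumberField ↥(W.divisionField 5) := NumberField.mk
  intro κE hκE
  exact classicalMuVanishes_of_classGroupPRank_succ_eq' κE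
    (CartanMuRoadFukudaDoorsTprime.totallyRamifiedFrom_zero_intermediateField_divisionField W 5 hirr
      (CartanMuRoadFukudaDoorsTprime.not_hasSurjectiveModNGaloisRep_of_hasSplitCartanNormalizerModPImage W himg) K κE hκE)
    (Nat.zero_le m) (hrk κE hκE)

end Leaves

/-! ### §1 (A) and U₀ at a `5Ns` row from the basis data and SIX μ-hypotheses — NO named fact for (A) -/

section MuForm

variable (W : WeierstrassCurve ℚ) [W.IsElliptic]

/-- **(A) at `(W,5)` on a `5Ns` row from six classical `μ`-hypotheses — NO named fact** (Ferrero–Washington replaced by the abelian leaves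
`K′ = L^⟨σ̄_uσ̄_v⁻¹, σ̄_w⟩`, `Z = L^⟨σ̄_uσ̄_v⁻¹, σ̄_u²σ̄_w⟩ (= ℚ(ζ₅))`, `Q₂ = L^⟨σ̄_uσ̄_v⁻¹, σ̄_wσ̄_u⟩`; Coates–Sujatha 3.4 PROVED): for every
cyclotomic `ℤ_5`-extension `κ` of `ℚ` the dual fine Selmer group of `W` over `ℚ_cyc` is finitely generated over `ℤ_5`. Route-free re-export of
`CoatesSujatha2005.fineSelmerDual_moduleFinite_of_splitCartanBasis_five_abelian`. CONDITIONAL on the displayed data; (A) asserted for no curve.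
[cite: CoatesSujatha2005, Thm. 3.4 (§3)] [cite: Serre1972, §2.2] [cite: Washington1997, §13.1] [cite: Lemmermeyer1994, §1] -/
theorem conjA_five_of_splitCartanBasis_of_mu6 [Fact (5 : ℕ).Prime]
    (e : W.geomTorsion (5 : ℕ) ≃+ (Fin 2 → ZMod 5))
    (he : ∀ σ : absoluteGaloisGroup ℚ, ∃ M ∈ splitCartanNormalizer 5, ∀ P : W.geomTorsion (5 : ℕ), e (σ • P) = M *ᵥ e P)
    (σu σv σw : absoluteGaloisGroup ℚ) (hσu : ∀ P : W.geomTorsion (5 : ℕ), e (σu • P) = !![2, 0; 0, 1] *ᵥ e P)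
    (hσv : ∀ P : W.geomTorsion (5 : ℕ), e (σv • P) = !![1, 0; 0, 2] *ᵥ e P)
    (hσw : ∀ P : W.geomTorsion (5 : ℕ), e (σw • P) = !![0, 1; 1, 0] *ᵥ e P)
    (hμP : ∀ κE : ZpExtension ↥(fixedField (Subgroup.zpowers (absRestrictNormalHom (W.divisionField 5) σv))) 5,
      κE.IsCyclotomic → ClassicalMuVanishes κE)
    (hμD : ∀ κE : ZpExtension ↥(fixedField (Subgroup.zpowers (absRestrictNormalHom (W.divisionField 5) σu *
        absRestrictNormalHom (W.divisionField 5) σu * absRestrictNormalHom (W.divisionField 5) σv))) 5,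
      κE.IsCyclotomic → ClassicalMuVanishes κE)
    (hμC : ∀ κE : ZpExtension ↥(fixedField (Subgroup.zpowers (absRestrictNormalHom (W.divisionField 5) σu *
        absRestrictNormalHom (W.divisionField 5) σv) ⊔ Subgroup.zpowers (absRestrictNormalHom (W.divisionField 5) σw))) 5,
      κE.IsCyclotomic → ClassicalMuVanishes κE)
    (hμK : ∀ κE : ZpExtension ↥(fixedField (Subgroup.zpowers (absRestrictNormalHom (W.divisionField 5) σu *
        (absRestrictNormalHom (W.divisionField 5) σv)⁻¹) ⊔ Subgroup.zpowers (absRestrictNormalHom (W.divisionField 5) σw))) 5,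
      κE.IsCyclotomic → ClassicalMuVanishes κE)
    (hμZ : ∀ κE : ZpExtension ↥(fixedField (Subgroup.zpowers (absRestrictNormalHom (W.divisionField 5) σu *
        (absRestrictNormalHom (W.divisionField 5) σv)⁻¹) ⊔ Subgroup.zpowers (absRestrictNormalHom (W.divisionField 5) σu *
        absRestrictNormalHom (W.divisionField 5) σu * absRestrictNormalHom (W.divisionField 5) σw))) 5,
      κE.IsCyclotomic → ClassicalMuVanishes κE)
    (hμQ : ∀ κE : ZpExtension ↥(fixedField (Subgroup.zpowers (absRestrictNormalHom (W.divisionField 5) σu *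
        (absRestrictNormalHom (W.divisionField 5) σv)⁻¹) ⊔ Subgroup.zpowers (absRestrictNormalHom (W.divisionField 5) σw *
        absRestrictNormalHom (W.divisionField 5) σu))) 5,
      κE.IsCyclotomic → ClassicalMuVanishes κE)
    (κ : ZpExtension ℚ 5) (hκ : κ.IsCyclotomic) :
    ∃ (γ : absoluteGaloisGroup ℚ) (D : W.FineSelmerDualData κ γ),
      Module.Finite ℤ_[5] (RestrictScalars ℤ_[5] (IwasawaAlgebra 5) D.X) :=
  CoatesSujatha2005.fineSelmerDual_moduleFinite_of_splitCartanBasis_five_abelian W e he σu σv σw hσu hσv hσw hμP hμD hμC hμK hμZ hμQ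
    κ hκ

variable [W.IsGloballyMinimal]

/-- **U₀ at a `5Ns` (t′) row from six classical `μ`-hypotheses**: `ord₅ #Ш(W) ≤ ord₅ #Ш_an(W)` (`MissingUpperBoundAt W 5`) for a rank-`0` (t′) row
(`Addv W 5`, `SubTprime W 5`, `W[5]` irreducible) from Kato's fine-Selmer reading (`hKatoA`), GZK (`hGZK`), modularity (`hmod`) — named facts — and
(A) from §1's six `μ`-hypotheses (NO `hCS`, NO `hFW`). CONDITIONAL; nothing booked; BSD for no curve.
[cite: Kato2004Asterisque, Thm. 14.5 (3) (p. 236), Thm. 12.5 (3) (p. 222)] [cite: CoatesSujatha2005, Thm. 3.4 (§3)] [cite: Washington1997, §13.1] -/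
theorem missingUpperBoundAt_five_tame_of_splitCartanBasis_of_mu6
    (hKatoA : Kato2004.rankZero_padicValNat_sha_add_padicValNat_tamagawa_le_of_additive_potGood_of_irreducible_of_fineSelmerDual_fg)
    (hGZK : rank_eq_analyticRank_of_analyticRank_le_one) (hmod : hasEntireLFunction_rat) [Fact (5 : ℕ).Prime]
    (hr : W.analyticRank = 0) (hadd : Addv W 5) (hT : SubTprime W 5) (hirr : W.HasIrreducibleModPGaloisRep 5)
    (e : W.geomTorsion (5 : ℕ) ≃+ (Fin 2 → ZMod 5))
    (he : ∀ σ : absoluteGaloisGroup ℚ, ∃ M ∈ splitCartanNormalizer 5, ∀ P : W.geomTorsion (5 : ℕ), e (σ • P) = M *ᵥ e P)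
    (σu σv σw : absoluteGaloisGroup ℚ) (hσu : ∀ P : W.geomTorsion (5 : ℕ), e (σu • P) = !![2, 0; 0, 1] *ᵥ e P)
    (hσv : ∀ P : W.geomTorsion (5 : ℕ), e (σv • P) = !![1, 0; 0, 2] *ᵥ e P)
    (hσw : ∀ P : W.geomTorsion (5 : ℕ), e (σw • P) = !![0, 1; 1, 0] *ᵥ e P)
    (hμP : ∀ κE : ZpExtension ↥(fixedField (Subgroup.zpowers (absRestrictNormalHom (W.divisionField 5) σv))) 5,
      κE.IsCyclotomic → ClassicalMuVanishes κE)
    (hμD : ∀ κE : ZpExtension ↥(fixedField (Subgroup.zpowers (absRestrictNormalHom (W.divisionField 5) σu *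
        absRestrictNormalHom (W.divisionField 5) σu * absRestrictNormalHom (W.divisionField 5) σv))) 5,
      κE.IsCyclotomic → ClassicalMuVanishes κE)
    (hμC : ∀ κE : ZpExtension ↥(fixedField (Subgroup.zpowers (absRestrictNormalHom (W.divisionField 5) σu *
        absRestrictNormalHom (W.divisionField 5) σv) ⊔ Subgroup.zpowers (absRestrictNormalHom (W.divisionField 5) σw))) 5,
      κE.IsCyclotomic → ClassicalMuVanishes κE)
    (hμK : ∀ κE : ZpExtension ↥(fixedField (Subgroup.zpowers (absRestrictNormalHom (W.divisionField 5) σu *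
        (absRestrictNormalHom (W.divisionField 5) σv)⁻¹) ⊔ Subgroup.zpowers (absRestrictNormalHom (W.divisionField 5) σw))) 5,
      κE.IsCyclotomic → ClassicalMuVanishes κE)
    (hμZ : ∀ κE : ZpExtension ↥(fixedField (Subgroup.zpowers (absRestrictNormalHom (W.divisionField 5) σu *
        (absRestrictNormalHom (W.divisionField 5) σv)⁻¹) ⊔ Subgroup.zpowers (absRestrictNormalHom (W.divisionField 5) σu *
        absRestrictNormalHom (W.divisionField 5) σu * absRestrictNormalHom (W.divisionField 5) σw))) 5,
      κE.IsCyclotomic → ClassicalMuVanishes κE)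
    (hμQ : ∀ κE : ZpExtension ↥(fixedField (Subgroup.zpowers (absRestrictNormalHom (W.divisionField 5) σu *
        (absRestrictNormalHom (W.divisionField 5) σv)⁻¹) ⊔ Subgroup.zpowers (absRestrictNormalHom (W.divisionField 5) σw *
        absRestrictNormalHom (W.divisionField 5) σu))) 5,
      κE.IsCyclotomic → ClassicalMuVanishes κE) :
    MissingUpperBoundAt W 5 :=
  CartanMuRoadDoorsTprimeFive.missingUpperBoundAt_tame_of_conjA W hKatoA hGZK hmod 5 hr (by decide) hadd hT hirr
    (conjA_five_of_splitCartanBasis_of_mu6 W e he σu σv σw hσu hσv hσw hμP hμD hμC hμK hμZ hμQ)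

end MuForm

/-! ### §2 (A) and U₀ at a `5Ns` row from CLASS DATA: five Iwasawa-1956 certificates and ONE Fukuda rank equality — NO named fact for (A) -/

section ClassData

variable (W : WeierstrassCurve ℚ) [W.IsElliptic]

/-- **(A) at `(W,5)` on a `5Ns` row from displayed class data — NO named fact**: `W[5]` irreducible, the split-Cartan basis data, and for each of
the five leaves `ℚ(P₁) = L^⟨σ̄_v⟩`, `L^⟨σ̄_u²σ̄_v⟩`, `ℚ(C) = L^⟨σ̄_uσ̄_v, σ̄_w⟩`, `K′ = L^⟨σ̄_uσ̄_v⁻¹, σ̄_w⟩`, `Z = L^⟨σ̄_uσ̄_v⁻¹, σ̄_u²σ̄_w⟩` the two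
integers «`5 ∤ h`» and «one prime above `5`» (Iwasawa 1956 PROVED), and for `Q₂ = L^⟨σ̄_uσ̄_v⁻¹, σ̄_wσ̄_u⟩` one rank equality
`rank₅ Cl((Q₂)_{m+1}) = rank₅ Cl((Q₂)_m)` (Fukuda (2) PROVED; total ramification kernel). CONDITIONAL on the displayed data; (A) asserted for no curve.
[cite: CoatesSujatha2005, Thm. 3.4 (§3)] [cite: Greenberg2001IwasawaPastPresent, Prop. (2.1) (p. 339)] [cite: Fukuda1994, Thm. 1 (2), p. 264]
[cite: Serre1972, §2.2] [cite: Washington1997, §13.1] -/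
theorem conjA_five_of_splitCartanBasis_of_classData [Fact (5 : ℕ).Prime] (hirr : W.HasIrreducibleModPGaloisRep 5)
    (e : W.geomTorsion (5 : ℕ) ≃+ (Fin 2 → ZMod 5))
    (he : ∀ σ : absoluteGaloisGroup ℚ, ∃ M ∈ splitCartanNormalizer 5, ∀ P : W.geomTorsion (5 : ℕ), e (σ • P) = M *ᵥ e P)
    (σu σv σw : absoluteGaloisGroup ℚ) (hσu : ∀ P : W.geomTorsion (5 : ℕ), e (σu • P) = !![2, 0; 0, 1] *ᵥ e P)
    (hσv : ∀ P : W.geomTorsion (5 : ℕ), e (σv • P) = !![1, 0; 0, 2] *ᵥ e P)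
    (hσw : ∀ P : W.geomTorsion (5 : ℕ), e (σw • P) = !![0, 1; 1, 0] *ᵥ e P)
    (hhP : haveI : NumberField ↥(W.divisionField 5) := NumberField.mk
      ¬ 5 ∣ NumberField.classNumber ↥(fixedField (Subgroup.zpowers (absRestrictNormalHom (W.divisionField 5) σv))))
    (hvP : haveI : NumberField ↥(W.divisionField 5) := NumberField.mk
      ∃! v : IsDedekindDomain.HeightOneSpectrum (𝓞 ↥(fixedField (Subgroup.zpowers (absRestrictNormalHom (W.divisionField 5) σv)))),
        ((5 : ℕ) : 𝓞 ↥(fixedField (Subgroup.zpowers (absRestrictNormalHom (W.divisionField 5) σv)))) ∈ v.asIdeal)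
    (hhD : haveI : NumberField ↥(W.divisionField 5) := NumberField.mk
      ¬ 5 ∣ NumberField.classNumber ↥(fixedField (Subgroup.zpowers (absRestrictNormalHom (W.divisionField 5) σu *
        absRestrictNormalHom (W.divisionField 5) σu * absRestrictNormalHom (W.divisionField 5) σv))))
    (hvD : haveI : NumberField ↥(W.divisionField 5) := NumberField.mk
      ∃! v : IsDedekindDomain.HeightOneSpectrum (𝓞 ↥(fixedField (Subgroup.zpowers (absRestrictNormalHom (W.divisionField 5) σu *
        absRestrictNormalHom (W.divisionField 5) σu * absRestrictNormalHom (W.divisionField 5) σv)))),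
        ((5 : ℕ) : 𝓞 ↥(fixedField (Subgroup.zpowers (absRestrictNormalHom (W.divisionField 5) σu *
        absRestrictNormalHom (W.divisionField 5) σu * absRestrictNormalHom (W.divisionField 5) σv)))) ∈ v.asIdeal)
    (hhC : haveI : NumberField ↥(W.divisionField 5) := NumberField.mk
      ¬ 5 ∣ NumberField.classNumber ↥(fixedField (Subgroup.zpowers (absRestrictNormalHom (W.divisionField 5) σu *
        absRestrictNormalHom (W.divisionField 5) σv) ⊔ Subgroup.zpowers (absRestrictNormalHom (W.divisionField 5) σw))))
    (hvC : haveI : NumberField ↥(W.divisionField 5) := NumberField.mk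
      ∃! v : IsDedekindDomain.HeightOneSpectrum (𝓞 ↥(fixedField (Subgroup.zpowers (absRestrictNormalHom (W.divisionField 5) σu *
        absRestrictNormalHom (W.divisionField 5) σv) ⊔ Subgroup.zpowers (absRestrictNormalHom (W.divisionField 5) σw)))),
        ((5 : ℕ) : 𝓞 ↥(fixedField (Subgroup.zpowers (absRestrictNormalHom (W.divisionField 5) σu *
        absRestrictNormalHom (W.divisionField 5) σv) ⊔ Subgroup.zpowers (absRestrictNormalHom (W.divisionField 5) σw)))) ∈ v.asIdeal)
    (hhK : haveI : NumberField ↥(W.divisionField 5) := NumberField.mk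
      ¬ 5 ∣ NumberField.classNumber ↥(fixedField (Subgroup.zpowers (absRestrictNormalHom (W.divisionField 5) σu *
        (absRestrictNormalHom (W.divisionField 5) σv)⁻¹) ⊔ Subgroup.zpowers (absRestrictNormalHom (W.divisionField 5) σw))))
    (hvK : haveI : NumberField ↥(W.divisionField 5) := NumberField.mk
      ∃! v : IsDedekindDomain.HeightOneSpectrum (𝓞 ↥(fixedField (Subgroup.zpowers (absRestrictNormalHom (W.divisionField 5) σu *
        (absRestrictNormalHom (W.divisionField 5) σv)⁻¹) ⊔ Subgroup.zpowers (absRestrictNormalHom (W.divisionField 5) σw)))),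
        ((5 : ℕ) : 𝓞 ↥(fixedField (Subgroup.zpowers (absRestrictNormalHom (W.divisionField 5) σu *
        (absRestrictNormalHom (W.divisionField 5) σv)⁻¹) ⊔ Subgroup.zpowers (absRestrictNormalHom (W.divisionField 5) σw)))) ∈ v.asIdeal)
    (hhZ : haveI : NumberField ↥(W.divisionField 5) := NumberField.mk
      ¬ 5 ∣ NumberField.classNumber ↥(fixedField (Subgroup.zpowers (absRestrictNormalHom (W.divisionField 5) σu *
        (absRestrictNormalHom (W.divisionField 5) σv)⁻¹) ⊔ Subgroup.zpowers (absRestrictNormalHom (W.divisionField 5) σu *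
        absRestrictNormalHom (W.divisionField 5) σu * absRestrictNormalHom (W.divisionField 5) σw))))
    (hvZ : haveI : NumberField ↥(W.divisionField 5) := NumberField.mk
      ∃! v : IsDedekindDomain.HeightOneSpectrum (𝓞 ↥(fixedField (Subgroup.zpowers (absRestrictNormalHom (W.divisionField 5) σu *
        (absRestrictNormalHom (W.divisionField 5) σv)⁻¹) ⊔ Subgroup.zpowers (absRestrictNormalHom (W.divisionField 5) σu *
        absRestrictNormalHom (W.divisionField 5) σu * absRestrictNormalHom (W.divisionField 5) σw)))),
        ((5 : ℕ) : 𝓞 ↥(fixedField (Subgroup.zpowers (absRestrictNormalHom (W.divisionField 5) σu *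
        (absRestrictNormalHom (W.divisionField 5) σv)⁻¹) ⊔ Subgroup.zpowers (absRestrictNormalHom (W.divisionField 5) σu *
        absRestrictNormalHom (W.divisionField 5) σu * absRestrictNormalHom (W.divisionField 5) σw)))) ∈ v.asIdeal)
    (m : ℕ)
    (hrkQ : haveI : NumberField ↥(W.divisionField 5) := NumberField.mk
      ∀ κE : ZpExtension ↥(fixedField (Subgroup.zpowers (absRestrictNormalHom (W.divisionField 5) σu *
        (absRestrictNormalHom (W.divisionField 5) σv)⁻¹) ⊔ Subgroup.zpowers (absRestrictNormalHom (W.divisionField 5) σw *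
        absRestrictNormalHom (W.divisionField 5) σu))) 5,
        κE.IsCyclotomic → classGroupPRank κE (m + 1) = classGroupPRank κE m)
    (κ : ZpExtension ℚ 5) (hκ : κ.IsCyclotomic) :
    ∃ (γ : absoluteGaloisGroup ℚ) (D : W.FineSelmerDualData κ γ),
      Module.Finite ℤ_[5] (RestrictScalars ℤ_[5] (IwasawaAlgebra 5) D.X) :=
  haveI : NumberField ↥(W.divisionField 5) := NumberField.mk
  conjA_five_of_splitCartanBasis_of_mu6 W e he σu σv σw hσu hσv hσw
    (CartanMuRoadSplitFiveIndexTwoAbelDoors.leafMu_of_classNumber' _ hhP hvP)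
    (CartanMuRoadSplitFiveIndexTwoAbelDoors.leafMu_of_classNumber' _ hhD hvD)
    (CartanMuRoadSplitFiveIndexTwoAbelDoors.leafMu_of_classNumber' _ hhC hvC)
    (CartanMuRoadSplitFiveIndexTwoAbelDoors.leafMu_of_classNumber' _ hhK hvK)
    (CartanMuRoadSplitFiveIndexTwoAbelDoors.leafMu_of_classNumber' _ hhZ hvZ)
    (leafMu_of_rankSuccEqAt W hirr ⟨e, he⟩ _ m hrkQ) κ hκ

variable [W.IsGloballyMinimal]

/-- **U₀ at a `5Ns` (t′) row from displayed class data**: `ord₅ #Ш(W) ≤ ord₅ #Ш_an(W)` (`MissingUpperBoundAt W 5`) for a rank-`0` (t′) row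
(`Addv W 5`, `SubTprime W 5`, `W[5]` irreducible) from Kato's fine-Selmer reading (`hKatoA`), GZK (`hGZK`), modularity (`hmod`) — the ONLY named
facts — and (A) from §2's class data (five Iwasawa-1956 certificates, one Fukuda rank equality). CONDITIONAL; nothing booked; BSD for no curve.
[cite: Kato2004Asterisque, Thm. 14.5 (3) (p. 236), Thm. 12.5 (3) (p. 222)] [cite: CoatesSujatha2005, Thm. 3.4 (§3)]
[cite: Greenberg2001IwasawaPastPresent, Prop. (2.1) (p. 339)] [cite: Fukuda1994, Thm. 1 (2), p. 264] -/
theorem missingUpperBoundAt_five_tame_of_splitCartanBasis_of_classData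
    (hKatoA : Kato2004.rankZero_padicValNat_sha_add_padicValNat_tamagawa_le_of_additive_potGood_of_irreducible_of_fineSelmerDual_fg)
    (hGZK : rank_eq_analyticRank_of_analyticRank_le_one) (hmod : hasEntireLFunction_rat) [Fact (5 : ℕ).Prime]
    (hr : W.analyticRank = 0) (hadd : Addv W 5) (hT : SubTprime W 5) (hirr : W.HasIrreducibleModPGaloisRep 5)
    (e : W.geomTorsion (5 : ℕ) ≃+ (Fin 2 → ZMod 5))
    (he : ∀ σ : absoluteGaloisGroup ℚ, ∃ M ∈ splitCartanNormalizer 5, ∀ P : W.geomTorsion (5 : ℕ), e (σ • P) = M *ᵥ e P)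
    (σu σv σw : absoluteGaloisGroup ℚ) (hσu : ∀ P : W.geomTorsion (5 : ℕ), e (σu • P) = !![2, 0; 0, 1] *ᵥ e P)
    (hσv : ∀ P : W.geomTorsion (5 : ℕ), e (σv • P) = !![1, 0; 0, 2] *ᵥ e P)
    (hσw : ∀ P : W.geomTorsion (5 : ℕ), e (σw • P) = !![0, 1; 1, 0] *ᵥ e P)
    (hhP : haveI : NumberField ↥(W.divisionField 5) := NumberField.mk
      ¬ 5 ∣ NumberField.classNumber ↥(fixedField (Subgroup.zpowers (absRestrictNormalHom (W.divisionField 5) σv))))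
    (hvP : haveI : NumberField ↥(W.divisionField 5) := NumberField.mk
      ∃! v : IsDedekindDomain.HeightOneSpectrum (𝓞 ↥(fixedField (Subgroup.zpowers (absRestrictNormalHom (W.divisionField 5) σv)))),
        ((5 : ℕ) : 𝓞 ↥(fixedField (Subgroup.zpowers (absRestrictNormalHom (W.divisionField 5) σv)))) ∈ v.asIdeal)
    (hhD : haveI : NumberField ↥(W.divisionField 5) := NumberField.mk
      ¬ 5 ∣ NumberField.classNumber ↥(fixedField (Subgroup.zpowers (absRestrictNormalHom (W.divisionField 5) σu *
        absRestrictNormalHom (W.divisionField 5) σu * absRestrictNormalHom (W.divisionField 5) σv))))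
    (hvD : haveI : NumberField ↥(W.divisionField 5) := NumberField.mk
      ∃! v : IsDedekindDomain.HeightOneSpectrum (𝓞 ↥(fixedField (Subgroup.zpowers (absRestrictNormalHom (W.divisionField 5) σu *
        absRestrictNormalHom (W.divisionField 5) σu * absRestrictNormalHom (W.divisionField 5) σv)))),
        ((5 : ℕ) : 𝓞 ↥(fixedField (Subgroup.zpowers (absRestrictNormalHom (W.divisionField 5) σu *
        absRestrictNormalHom (W.divisionField 5) σu * absRestrictNormalHom (W.divisionField 5) σv)))) ∈ v.asIdeal)
    (hhC : haveI : NumberField ↥(W.divisionField 5) := NumberField.mk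
      ¬ 5 ∣ NumberField.classNumber ↥(fixedField (Subgroup.zpowers (absRestrictNormalHom (W.divisionField 5) σu *
        absRestrictNormalHom (W.divisionField 5) σv) ⊔ Subgroup.zpowers (absRestrictNormalHom (W.divisionField 5) σw))))
    (hvC : haveI : NumberField ↥(W.divisionField 5) := NumberField.mk
      ∃! v : IsDedekindDomain.HeightOneSpectrum (𝓞 ↥(fixedField (Subgroup.zpowers (absRestrictNormalHom (W.divisionField 5) σu *
        absRestrictNormalHom (W.divisionField 5) σv) ⊔ Subgroup.zpowers (absRestrictNormalHom (W.divisionField 5) σw)))),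
        ((5 : ℕ) : 𝓞 ↥(fixedField (Subgroup.zpowers (absRestrictNormalHom (W.divisionField 5) σu *
        absRestrictNormalHom (W.divisionField 5) σv) ⊔ Subgroup.zpowers (absRestrictNormalHom (W.divisionField 5) σw)))) ∈ v.asIdeal)
    (hhK : haveI : NumberField ↥(W.divisionField 5) := NumberField.mk
      ¬ 5 ∣ NumberField.classNumber ↥(fixedField (Subgroup.zpowers (absRestrictNormalHom (W.divisionField 5) σu *
        (absRestrictNormalHom (W.divisionField 5) σv)⁻¹) ⊔ Subgroup.zpowers (absRestrictNormalHom (W.divisionField 5) σw))))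
    (hvK : haveI : NumberField ↥(W.divisionField 5) := NumberField.mk
      ∃! v : IsDedekindDomain.HeightOneSpectrum (𝓞 ↥(fixedField (Subgroup.zpowers (absRestrictNormalHom (W.divisionField 5) σu *
        (absRestrictNormalHom (W.divisionField 5) σv)⁻¹) ⊔ Subgroup.zpowers (absRestrictNormalHom (W.divisionField 5) σw)))),
        ((5 : ℕ) : 𝓞 ↥(fixedField (Subgroup.zpowers (absRestrictNormalHom (W.divisionField 5) σu *
        (absRestrictNormalHom (W.divisionField 5) σv)⁻¹) ⊔ Subgroup.zpowers (absRestrictNormalHom (W.divisionField 5) σw)))) ∈ v.asIdeal)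
    (hhZ : haveI : NumberField ↥(W.divisionField 5) := NumberField.mk
      ¬ 5 ∣ NumberField.classNumber ↥(fixedField (Subgroup.zpowers (absRestrictNormalHom (W.divisionField 5) σu *
        (absRestrictNormalHom (W.divisionField 5) σv)⁻¹) ⊔ Subgroup.zpowers (absRestrictNormalHom (W.divisionField 5) σu *
        absRestrictNormalHom (W.divisionField 5) σu * absRestrictNormalHom (W.divisionField 5) σw))))
    (hvZ : haveI : NumberField ↥(W.divisionField 5) := NumberField.mk
      ∃! v : IsDedekindDomain.HeightOneSpectrum (𝓞 ↥(fixedField (Subgroup.zpowers (absRestrictNormalHom (W.divisionField 5) σu *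
        (absRestrictNormalHom (W.divisionField 5) σv)⁻¹) ⊔ Subgroup.zpowers (absRestrictNormalHom (W.divisionField 5) σu *
        absRestrictNormalHom (W.divisionField 5) σu * absRestrictNormalHom (W.divisionField 5) σw)))),
        ((5 : ℕ) : 𝓞 ↥(fixedField (Subgroup.zpowers (absRestrictNormalHom (W.divisionField 5) σu *
        (absRestrictNormalHom (W.divisionField 5) σv)⁻¹) ⊔ Subgroup.zpowers (absRestrictNormalHom (W.divisionField 5) σu *
        absRestrictNormalHom (W.divisionField 5) σu * absRestrictNormalHom (W.divisionField 5) σw)))) ∈ v.asIdeal)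
    (m : ℕ)
    (hrkQ : haveI : NumberField ↥(W.divisionField 5) := NumberField.mk
      ∀ κE : ZpExtension ↥(fixedField (Subgroup.zpowers (absRestrictNormalHom (W.divisionField 5) σu *
        (absRestrictNormalHom (W.divisionField 5) σv)⁻¹) ⊔ Subgroup.zpowers (absRestrictNormalHom (W.divisionField 5) σw *
        absRestrictNormalHom (W.divisionField 5) σu))) 5,
        κE.IsCyclotomic → classGroupPRank κE (m + 1) = classGroupPRank κE m) :
    MissingUpperBoundAt W 5 :=
  CartanMuRoadDoorsTprimeFive.missingUpperBoundAt_tame_of_conjA W hKatoA hGZK hmod 5 hr (by decide) hadd hT hirr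
    (conjA_five_of_splitCartanBasis_of_classData W hirr e he σu σv σw hσu hσv hσw hhP hvP hhD hvD hhC hvC hhK hvK hhZ hvZ m hrkQ)

end ClassData

end Summit.BirchSwinnertonDyer.BirchSwinnertonDyer.Theorems.CartanMuRoadSplitFiveAbelDoors

end
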